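import Summits.HodgeConjecture.HodgeConjecture.Theorems.Q8CommutatorDegreeTwoCoreTransvections
import Summits.HodgeConjecture.HodgeConjecture.Theorems.SignCommutatorDegreeTwoCore

/-!
# K2Q first rung (route `Q8SymplecticPowers`) — the degree-2 core of the quaternionic centraliser

BC5 / T3 rung witness for crux `PowersHodgeOfQuaternionCommutators` (rank 3) of route
`Q8SymplecticPowers` (hodge-nonav P3): the quaternionic twin of
`Theorems.SignCommutatorDegreeTwoCore` (route `SignSymmetricPowers`).

Pure linear algebra over a field `K` of characteristic zero containing a square root `i` of `-1`
(the route needs `K = ℚ(i) ⊂ ℂ`: the statement is the `k ≤ 1` core of K2Q after base change to a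
splitting field of the definite quaternion algebra `D = (-1,-1)_ℚ`).  Data: a non-degenerate
SYMMETRIC bilinear form `Q` on `V` (weight-2 cup product) and two `Q`-isometries `a b` with
`a (a x) = -x`, `b (b x) = -x`, `a (b x) = - b (a x)` — the relations of the typed deck pair
`(pull τ 2, pull j 2)` of the route file (`τ*⁴ = 1`, `j*² = τ*²`, `j* τ* = τ*³ j*`) restricted to the
`(-1)`-eigenspace of `τ*²`, which contains the transcendental lattice.  The *quaternionic centraliser*
is the group of `Q`-isometries `g : V ≃ₗ[K] V` commuting with `a` and `b` (abstractly `Sp(M, ω)`,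
`M = ker (a - i)`, `ω x y = Q x (b y)` — the symplectic sign that makes the route determinant-free).

## Main results

* `qtransvection_*` — the quaternionic transvections
  `x ↦ x + (l * Q x (b v)) • v - (l * Q x v) • b v` along an `i`-eigenvector `v` of `a` are
  `Q`-isometries commuting with `a` and `b`.
* `exists_q8Centraliser_commutator_eq_qtransvection` — each of them is a commutator
  `g * h * g⁻¹ * h⁻¹` of two elements of the quaternionic centraliser (hyperbolic dilation on a pair
  `v, w ∈ M`, `Q v (b w) = 1`, against the transvection with parameter `l / 3`).
* `q8Commutator_invariant_bilinForm_eq` (= rung `Q8CommutatorDegreeTwoCore`) — a bilinear form `c` on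
  `V` invariant under every such commutator is `x y ↦ Q x (d y)` for a unique-shape
  `d = α + β a + γ b + δ a b ∈ D ⊗ K`: the degree-2 instance of the first fundamental theorem for
  `Sp(M)`, reached from COMMUTATOR invariance only (the hypothesis shape of `Comm` in K2Q).

The transvection / dilation toolkit (§0–§2, §1b) lives in part 1,
`Theorems.Q8CommutatorDegreeTwoCoreTransvections` (split for the 400-line lint); the pointwise commutator
lemma `commutator_apply_of` is cited from `Theorems.SignCommutatorDegreeTwoCore`.
hodge-nonav planner P3 g35, 2026-08-29.  No new axioms, no sorries; imports part 1 (itself `import Mathlib` only).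
-/

namespace Summit.HodgeConjecture.HodgeConjecture.Theorems.Q8CommutatorDegreeTwoCore

open LinearMap
open Summit.HodgeConjecture.HodgeConjecture.Theorems.Q8CommutatorDegreeTwoCoreTransvections

variable {K V : Type*} [Field K] [AddCommGroup V] [Module K V] {Q : LinearMap.BilinForm K V}


/-- In `M` there is a hyperbolic partner `w` of a non-zero `v ∈ M`: `Q v (b w) = 1`. -/
theorem exists_hyperbolic_partner [CharZero K] (hQs : ∀ x y, Q x y = Q y x)
    (hQn : Q.Nondegenerate) {a b : V →ₗ[K] V} (haa : ∀ x, a (a x) = -x) (hbb : ∀ x, b (b x) = -x)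
    (hab : ∀ x, a (b x) = -b (a x)) (haQ : ∀ x y, Q (a x) (a y) = Q x y) {i : K} (hi : i * i = -1)
    {v : V} (hv0 : v ≠ 0) (hv : a v = i • v) : ∃ w : V, a w = i • w ∧ Q v (b w) = 1 := by
  obtain ⟨y, hy⟩ : ∃ y, Q v y ≠ 0 := by
    by_contra! h
    exact hv0 (hQn.1 v h)
  set w₁ := -b (y + i • a y) with hw₁
  have haw₁ : a w₁ = i • w₁ := by
    simp only [hw₁, map_neg, map_add, map_smul, hab, haa, smul_neg, neg_neg, smul_add, smul_smul, hi]
    module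
  have hbw₁ : b w₁ = y + i • a y := by
    rw [hw₁, map_neg, hbb, neg_neg]
  have hQ₁ : Q v (b w₁) = 2 * Q v y := by
    have h2 : Q v (a y) = -(i * Q v y) := by
      rw [hQs v (a y), apply_a_eigenvector haQ hi hv y, hQs y v]
    rw [hbw₁, map_add, map_smul, smul_eq_mul, h2]
    linear_combination (-(Q v y)) * hi
  have hQ₁0 : Q v (b w₁) ≠ 0 := by rw [hQ₁]; exact mul_ne_zero two_ne_zero hy
  refine ⟨(Q v (b w₁))⁻¹ • w₁, ?_, ?_⟩
  · rw [map_smul, haw₁, smul_comm]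
  · rw [map_smul, map_smul, smul_eq_mul, inv_mul_cancel₀ hQ₁0]

variable (Q)

/-- **Quaternionic transvections are commutators in the quaternionic centraliser.**
For `v` with `a v = i • v` and any `l`, the transvection
`x ↦ x + (l * Q x (b v)) • v - (l * Q x v) • b v` equals `g * h * g⁻¹ * h⁻¹` for `Q`-isometries
`g h` commuting with `a` and `b`. -/
theorem exists_q8Centraliser_commutator_eq_qtransvection [CharZero K]
    (hQs : ∀ x y, Q x y = Q y x) (hQn : Q.Nondegenerate)
    (a b : V →ₗ[K] V) (haa : ∀ x, a (a x) = -x) (hbb : ∀ x, b (b x) = -x)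
    (hab : ∀ x, a (b x) = -b (a x))
    (haQ : ∀ x y, Q (a x) (a y) = Q x y) (hQb : ∀ x y, Q (b x) (b y) = Q x y)
    {i : K} (hi : i * i = -1) {v : V} (hv : a v = i • v) (l : K) :
    ∃ g h : V ≃ₗ[K] V,
      ((∀ x, g (a x) = a (g x)) ∧ (∀ x, g (b x) = b (g x)) ∧ ∀ x y, Q (g x) (g y) = Q x y) ∧
      ((∀ x, h (a x) = a (h x)) ∧ (∀ x, h (b x) = b (h x)) ∧ ∀ x y, Q (h x) (h y) = Q x y) ∧
      ∀ x, (g * h * g⁻¹ * h⁻¹) x = x + (l * Q x (b v)) • v + (-(l * Q x v)) • b v := by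
  rcases eq_or_ne v 0 with rfl | hv0
  · exact ⟨1, 1, ⟨fun x => rfl, fun x => rfl, fun x y => rfl⟩,
      ⟨fun x => rfl, fun x => rfl, fun x y => rfl⟩, fun x => by simp⟩
  obtain ⟨w, hw, hvw⟩ := exists_hyperbolic_partner hQs hQn haa hbb hab haQ hi hv0 hv
  obtain ⟨D, hD⟩ := exists_qdilation_equiv hQs haQ hbb hQb hi hv hw hvw
  obtain ⟨T, hT⟩ := exists_qtransvection_equiv hQs haQ hbb hQb hi hv (l / 3)
  refine ⟨D, T,
    ⟨fun x => qdilation_comm_a haQ hi hv hw hab hD x,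
      fun x => qdilation_comm_b hQs hbb hQb hD x,
      fun x y => qdilation_isometry hQs haQ hbb hQb hi hv hw hvw (by norm_num) hD x y⟩,
    ⟨fun x => qtransvection_comm_a haQ hi hv hab hT x, fun x => qtransvection_comm_b hQs hbb hQb hT x,
      fun x y => qtransvection_isometry hQs haQ hbb hQb hi hv hT x y⟩, ?_⟩
  obtain ⟨t1, t2, t3, t4⟩ := table_v hQs haQ hbb hQb hi hv
  refine SignCommutatorDegreeTwoCore.commutator_apply_of fun y => ?_
  show D (T y) = T (D y) + (l * Q (T (D y)) (b v)) • v + (-(l * Q (T (D y)) v)) • b v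
  rw [qdilation_qtransvection hQs haQ hbb hQb hi hv hw hvw (l'' := l + l / 3) (by ring) hD hT,
    hT (D y)]
  simp only [map_add, map_smul, LinearMap.add_apply, LinearMap.smul_apply, smul_eq_mul,
    t1, t2, t3, t4, mul_zero]
  module

/-- **Rung `Q8CommutatorDegreeTwoCore`** (degree-2 core of crux `PowersHodgeOfQuaternionCommutators`):
over a field of characteristic zero containing `i` with `i * i = -1`, a bilinear form invariant
under all commutators of the quaternionic centraliser is `x y ↦ Q x (d y)` for some
`d = α + β a + γ b + δ a b` in the (split) quaternion algebra generated by `a, b`. -/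
theorem q8Commutator_invariant_bilinForm_eq [CharZero K]
    (hQs : ∀ x y, Q x y = Q y x) (hQn : Q.Nondegenerate)
    (a b : V →ₗ[K] V) (haa : ∀ x, a (a x) = -x) (hbb : ∀ x, b (b x) = -x)
    (hab : ∀ x, a (b x) = -b (a x))
    (haQ : ∀ x y, Q (a x) (a y) = Q x y) (hQb : ∀ x y, Q (b x) (b y) = Q x y)
    {i : K} (hi : i * i = -1) (c : LinearMap.BilinForm K V)
    (hc : ∀ g h : V ≃ₗ[K] V, (∀ x, g (a x) = a (g x)) → (∀ x, g (b x) = b (g x)) →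
      (∀ x y, Q (g x) (g y) = Q x y) → (∀ x, h (a x) = a (h x)) → (∀ x, h (b x) = b (h x)) →
      (∀ x y, Q (h x) (h y) = Q x y) →
      ∀ x y, c ((g * h * g⁻¹ * h⁻¹) x) ((g * h * g⁻¹ * h⁻¹) y) = c x y) :
    ∃ α β γ δ : K, ∀ x y,
      c x y = α * Q x y + β * Q x (a y) + γ * Q x (b y) + δ * Q x (a (b y)) := by
  -- (0) invariance of `c` under every quaternionic transvection along `v ∈ M`
  have hT : ∀ {v : V}, a v = i • v → ∀ (l : K) (x y : V),
      c (x + (l * Q x (b v)) • v + (-(l * Q x v)) • b v)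
        (y + (l * Q y (b v)) • v + (-(l * Q y v)) • b v) = c x y := by
    intro v hv l x y
    obtain ⟨g, h, ⟨hg1, hg2, hg3⟩, ⟨hh1, hh2, hh3⟩, hgh⟩ :=
      exists_q8Centraliser_commutator_eq_qtransvection Q hQs hQn a b haa hbb hab haQ hQb hi hv l
    have := hc g h hg1 hg2 hg3 hh1 hh2 hh3 x y
    rwa [hgh x, hgh y] at this
  have expand : ∀ (l : K) (v x y : V),
      c (x + (l * Q x (b v)) • v + (-(l * Q x v)) • b v)
        (y + (l * Q y (b v)) • v + (-(l * Q y v)) • b v) =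
      c x y + l * (Q y (b v) * c x v - Q y v * c x (b v) + Q x (b v) * c v y - Q x v * c (b v) y)
        + l * l * (Q x (b v) * Q y (b v) * c v v - Q x (b v) * Q y v * c v (b v)
          - Q x v * Q y (b v) * c (b v) v + Q x v * Q y v * c (b v) (b v)) := by
    intro l v x y
    simp only [map_add, map_smul, LinearMap.add_apply, LinearMap.smul_apply, smul_eq_mul]
    ring
  -- (A) the basic identity from invariance under `T_{v,1}` and `T_{v,-1}`
  have hA : ∀ {v : V}, a v = i • v → ∀ x y,
      Q y (b v) * c x v - Q y v * c x (b v) + Q x (b v) * c v y - Q x v * c (b v) y = 0 := by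
    intro v hv x y
    have h1 := hT hv 1 x y
    have h2 := hT hv (-1) x y
    rw [expand] at h1 h2
    linear_combination (1 / 2 : K) * h1 - (1 / 2 : K) * h2
  -- shorthand facts
  have iso : ∀ {x u : V}, a x = i • x → a u = i • u → Q x u = 0 := fun hx hu =>
    eigen_isotropic haQ hi hx hu
  have bl : ∀ x y, Q (b x) y = -Q x (b y) := b_left hQs hbb hQb
  -- (B) the four block identities, over `M = eigenspace a i`
  set M := Module.End.eigenspace a i with hM
  have memM : ∀ {x : V}, x ∈ M ↔ a x = i • x := fun {x} => by
    rw [hM, Module.End.mem_eigenspace_iff]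
  have hmem : ∀ x : M, a (x : V) = i • (x : V) := fun x => memM.mp x.2
  set S := M.subtype with hS
  set ωM : LinearMap.BilinForm K M := (Q.compl₂ b).compl₁₂ S S with hωM
  have ωM_apply : ∀ x u : M, ωM x u = Q (x : V) (b (u : V)) := fun x u => rfl
  -- right non-degeneracy of `ωM`
  have hωr : ∀ u : M, (∀ x : M, ωM x u = 0) → u = 0 := by
    intro u hu
    have hbu : a (b (u : V)) = (-i) • b (u : V) := b_eigen hab (hmem u)
    have hmi : (-i) * (-i) = -1 := by linear_combination hi
    have key : ∀ z : V, Q z (b (u : V)) = 0 := by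
      intro z
      have hz1 : a (z - i • a z) = i • (z - i • a z) := by
        simp only [map_sub, map_smul, haa, smul_neg]
        linear_combination (norm := module) hi • a z
      have hz2 : a (z + i • a z) = (-i) • (z + i • a z) := by
        simp only [map_add, map_smul, haa, smul_neg]
        linear_combination (norm := module) hi • a z
      have e1 : Q (z - i • a z) (b (u : V)) = 0 := by
        have := hu ⟨z - i • a z, memM.mpr hz1⟩
        rwa [ωM_apply] at this
      have e2 : Q (z + i • a z) (b (u : V)) = 0 := eigen_isotropic haQ hmi hz2 hbu
      have e3 : (2 : K) * Q z (b (u : V)) = 0 := by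
        have := congrArg₂ (· + ·) e1 e2
        simp only [map_sub, map_add, map_smul, LinearMap.sub_apply, LinearMap.add_apply,
          LinearMap.smul_apply, smul_eq_mul, add_zero] at this
        linear_combination this
      simpa using e3
    have hbu0 : b (u : V) = 0 := hQn.2 _ key
    have hu0 : (u : V) = 0 := by
      have := hbb (u : V)
      rw [hbu0, map_zero] at this
      exact neg_eq_zero.mp this.symm
    exact Subtype.ext hu0
  -- the four transported block forms on `M`
  obtain ⟨μ₁, hμ₁⟩ := multiplier_of_identity ωM hωr (c.compl₁₂ S S) (fun u x y => by
    simp only [ωM_apply, LinearMap.compl₁₂_apply, hS, Submodule.subtype_apply]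
    have h := hA (hmem u) (x : V) (y : V)
    rw [iso (hmem y) (hmem u), iso (hmem x) (hmem u)] at h
    linear_combination h)
  obtain ⟨μ₂, hμ₂⟩ := multiplier_of_identity ωM hωr ((c.compl₂ b).compl₁₂ S S) (fun u x y => by
    simp only [ωM_apply, LinearMap.compl₁₂_apply, LinearMap.compl₂_apply, hS,
      Submodule.subtype_apply]
    have h := hA (hmem u) (x : V) (b (y : V))
    rw [hQb, iso (hmem y) (hmem u), bl (y : V) (u : V), iso (hmem x) (hmem u)] at h
    linear_combination h)
  obtain ⟨μ₃, hμ₃⟩ := multiplier_of_identity ωM hωr ((c ∘ₗ b).compl₁₂ S S) (fun u x y => by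
    simp only [ωM_apply, LinearMap.compl₁₂_apply, LinearMap.comp_apply, hS,
      Submodule.subtype_apply]
    have h := hA (hmem u) (b (x : V)) (y : V)
    rw [hQb, iso (hmem y) (hmem u), iso (hmem x) (hmem u), bl (x : V) (u : V)] at h
    linear_combination h)
  obtain ⟨μ₄, hμ₄⟩ := multiplier_of_identity ωM hωr (((c ∘ₗ b).compl₂ b).compl₁₂ S S)
    (fun u x y => by
    simp only [ωM_apply, LinearMap.compl₁₂_apply, LinearMap.compl₂_apply, LinearMap.comp_apply, hS,
      Submodule.subtype_apply]
    have h := hA (hmem u) (b (x : V)) (b (y : V))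
    rw [hQb, hQb, iso (hmem y) (hmem u), iso (hmem x) (hmem u), bl (x : V) (u : V),
      bl (y : V) (u : V)] at h
    linear_combination h)
  -- the block identities in `V`-terms
  have B1 : ∀ {m n : V}, a m = i • m → a n = i • n → c m n = μ₁ * Q m (b n) := fun {m n} hm hn => by
    have := hμ₁ ⟨m, memM.mpr hm⟩ ⟨n, memM.mpr hn⟩
    simpa [ωM_apply, hS] using this
  have B2 : ∀ {m n : V}, a m = i • m → a n = i • n → c m (b n) = μ₂ * Q m (b n) :=
    fun {m n} hm hn => by
    have := hμ₂ ⟨m, memM.mpr hm⟩ ⟨n, memM.mpr hn⟩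
    simpa [ωM_apply, hS] using this
  have B3 : ∀ {m n : V}, a m = i • m → a n = i • n → c (b m) n = μ₃ * Q m (b n) :=
    fun {m n} hm hn => by
    have := hμ₃ ⟨m, memM.mpr hm⟩ ⟨n, memM.mpr hn⟩
    simpa [ωM_apply, hS] using this
  have B4 : ∀ {m n : V}, a m = i • m → a n = i • n → c (b m) (b n) = μ₄ * Q m (b n) :=
    fun {m n} hm hn => by
    have := hμ₄ ⟨m, memM.mpr hm⟩ ⟨n, memM.mpr hn⟩
    simpa [ωM_apply, hS] using this
  -- (E) assemble: every vector is `m + b m'` with `m m' ∈ M`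
  have decomp : ∀ x : V, ∃ m m' : V, a m = i • m ∧ a m' = i • m' ∧ x = m + b m' := by
    intro x
    refine ⟨(1 / 2 : K) • (x - i • a x), (-(1 / 2 : K)) • b (x + i • a x), ?_, ?_, ?_⟩
    · simp only [map_smul, map_sub, haa, smul_neg]
      linear_combination (norm := module) ((1 / 2 : K) * hi) • a x
    · simp only [map_smul, map_neg, map_add, hab, haa, smul_neg]
      linear_combination (norm := module) ((1 / 2 : K) * hi) • b (a x)
    · simp only [map_smul, map_add, hbb, map_smul, smul_add, smul_neg]
      module
  refine ⟨(μ₂ - μ₃) / 2, i * (μ₂ + μ₃) / 2, (μ₁ + μ₄) / 2, i * (μ₁ - μ₄) / 2, fun x y => ?_⟩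
  obtain ⟨m, m', hm, hm', rfl⟩ := decomp x
  obtain ⟨n, n', hn, hn', rfl⟩ := decomp y
  have e1 := B1 hm hn
  have e2 := B2 hm hn'
  have e3 := B3 hm' hn
  have e4 := B4 hm' hn'
  have hbn : a (b n) = (-i) • b n := b_eigen hab hn
  have hbn' : a (b n') = (-i) • b n' := b_eigen hab hn'
  have z1 : Q m n = 0 := iso hm hn
  have z2 : Q m' n' = 0 := iso hm' hn'
  have z3 : Q m' n = 0 := iso hm' hn
  have z4 : Q m n' = 0 := iso hm hn'
  simp only [map_add, map_smul, map_neg, LinearMap.add_apply, smul_eq_mul, hn, hbn', hbb, hab, hn',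
    hQb, bl m' n, bl m' n', z1, z2, z3, z4, e1, e2, e3, e4, neg_neg, mul_neg, add_zero, zero_add]
  linear_combination ((μ₂ + μ₃) / 2 * (Q m (b n') + Q m' (b n)) -
    (μ₁ - μ₄) / 2 * (Q m' (b n') - Q m (b n))) * hi

/-- Rung `Q8CommutatorDegreeTwoCore` in fully quantified form (the shape to register as the BC5 / T3
witness of route `Q8SymplecticPowers`, crux `PowersHodgeOfQuaternionCommutators`). -/
theorem rung_q8CommutatorDegreeTwoCore : ∀ (K V : Type _) [Field K] [CharZero K] [AddCommGroup V] [Module K V] (Q : LinearMap.BilinForm K V), (∀ x y, Q x y = Q y x) → Q.Nondegenerate → ∀ (a b : V →ₗ[K] V), (∀ x, a (a x) = -x) → (∀ x, b (b x) = -x) → (∀ x, a (b x) = -b (a x)) → (∀ x y, Q (a x) (a y) = Q x y) → (∀ x y, Q (b x) (b y) = Q x y) → ∀ (i : K), i * i = -1 → ∀ (c : LinearMap.BilinForm K V), (∀ g h : V ≃ₗ[K] V, (∀ x, g (a x) = a (g x)) → (∀ x, g (b x) = b (g x)) → (∀ x y, Q (g x) (g y) = Q x y) → (∀ x, h (a x)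 = a (h x)) → (∀ x, h (b x) = b (h x)) → (∀ x y, Q (h x) (h y) = Q x y) → ∀ x y, c ((g * h * g⁻¹ * h⁻¹) x) ((g * h * g⁻¹ * h⁻¹) y) = c x y) → ∃ α β γ δ : K, ∀ x y, c x y = α * Q x y + β * Q x (a y) + γ * Q x (b y) + δ * Q x (a (b y)) :=
  fun _ _ _ _ _ _ Q hQs hQn a b haa hbb hab haQ hQb _ hi c hc =>
    q8Commutator_invariant_bilinForm_eq Q hQs hQn a b haa hbb hab haQ hQb hi c hc

end Summit.HodgeConjecture.HodgeConjecture.Theorems.Q8CommutatorDegreeTwoCore
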